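import Summits.Ventures.GridStability.Models.StructurePreserving
import Summits.Ventures.GridStability.Models.ClassicalSwing

/-!
# GridStability/Models/StructurePreservingClassical — the lossless internal-node model is the
structure-preserving model with every node a generator

LADDER-GRIDFUSION rung G3 (model register), seat gridfusion-model-2; `plan/MODEL-VALIDITY.md` rows
**MV-2L** (lossless network-reduced classical model) and **MV-3** (Bergen–Hill structure-preserving
model), and the modifier row **MV-ω** («freq-shift»). The register states, and this file
KERNEL-CHECKS, that the LOSSLESS classical network-reduced `n`-machine model typed by model-1
(`Summit.Ventures.GridStability.Models.ClassicalSwing`, [cite: AndersonFouad1977, §2.9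
eqs (2.53)–(2.57)]; [cite: SauerPai1998, §7.9.3 eqs (7.209)–(7.216)], with transfer conductances
`G_ij = 0`, `i ≠ j`) is the special case `gen = univ` (no load buses) of the structure-preserving
model [cite: Padiyar2013, §3.2 eq (3.2)] typed by model-2 (`…StructurePreserving.Params`), with
`b_ij = C_ij = E_iE_jB_ij` and `P⁰_i = P_i − E_i²G_ii` — exactly the identification printed in
[cite: Padiyar2013, §2.2.4 Remarks 1–2] («it is possible to define P′_mi = P_mi − E_i²G_ii as the
net generator power … in this case, there is no loss of energy in the transmission lines»).

## What is proved
* `Params.ofClassical p` and its projections; `wellFormed_ofClassical`.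
* `ofClassical_pe` (lossless): `pe = Pe − E²G_ii`; `swing_ofClassical`: model-1's vector field
  satisfies model-2's node equation `Mᵢ ω̇ᵢ + Dᵢ ωᵢ + fᵢ(δ) = P⁰ᵢ`.
* `sum_P0_eq_zero_of_isEquilibrium` / `not_isEquilibrium_of_sum_ne_zero`: a synchronous
  equilibrium of the lossless model forces the power balance `Σᵢ (Pᵢ − Eᵢ²Gᵢᵢ) = 0`; with an
  imbalance there is NO synchronous equilibrium — the kernel form (lossless case) of model-4's
  OBJECTION-WITH-NUMBERS recorded as PARTITION A11″ / MODEL-VALIDITY MV-ω; then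
  `syncFreq_ofClassical_eq_zero`, `isSyncEquilibrium_ofClassical`.
* `isSolution_ofClassical`: model-1's solutions on `Set.univ` are model-2's `IsSolution`s (and the
  speeds are the angle derivatives); `isSolution_shift_ofClassical`: the rotating-frame statement of
  MV-ω for classical solutions.
* `sum_upper_eq_half_sum` (folklore finite-sum lemma) and `ofClassical_energy`: AT AN EQUILIBRIUM
  `δˢ`, model-1's classical transient energy function [cite: SauerPai1998, §9] IS Bergen–Hill's
  topological Lyapunov function (3.11) of the `gen = univ` structure-preserving data — the linear
  «rotor position» term `−Σ P′ᵢ(δᵢ − δᵢˢ)` is the `(σ − σ₀) sin σ₀` part of the branch integrals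
  summed through the equilibrium equations.
* `hasDerivAt_classicalEnergy`: consequently dE/dt = −Σᵢ Dᵢ ωᵢ² along model-1's solutions — the
  dissipation identity for model-1's typed energy, obtained from model-2's `hasDerivAt_energy`
  without re-deriving any calculus.

MODELLED (three columns): statements about the mathematical models MV-2L / MV-3 only; the LOSSY
model of record for G1.b (MV-2, transfer conductances kept) is NOT covered by the structure-
preserving dictionary (its injections carry `cos` terms) — only `swing`-type bookkeeping would
transfer. Nothing here is a certificate and nothing is said about any grid.
-/

noncomputable section

open Finset

namespace Summit.Ventures.GridStability.Models.StructurePreserving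

variable {n : ℕ}

/-- Folklore finite-sum lemma: for a symmetric array with zero diagonal, the sum over the pairs
`i < j` is half the full double sum. -/
theorem sum_upper_eq_half_sum (f : Fin n → Fin n → ℝ) (hs : ∀ i j, f i j = f j i)
    (hd : ∀ i, f i i = 0) :
    ∑ i, ∑ j ∈ univ.filter (fun j => i < j), f i j = (1 / 2) * ∑ i, ∑ j, f i j := by
  have hsplit : ∀ i j, f i j = (if i < j then f i j else 0) + (if j < i then f i j else 0) := by
    intro i j
    rcases lt_trichotomy i j with h | h | h
    · simp [h, not_lt.2 h.le]
    · subst h; simp [hd]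
    · simp [h, not_lt.2 h.le]
  have hlow : ∑ i, ∑ j, (if j < i then f i j else 0) = ∑ i, ∑ j, (if i < j then f i j else 0) := by
    rw [Finset.sum_comm]
    refine Finset.sum_congr rfl fun i _ => Finset.sum_congr rfl fun j _ => ?_
    rw [hs j i]
  have htot : ∑ i, ∑ j, f i j
      = ∑ i, ∑ j, (if i < j then f i j else 0) + ∑ i, ∑ j, (if j < i then f i j else 0) := by
    rw [← Finset.sum_add_distrib]
    refine Finset.sum_congr rfl fun i _ => ?_
    rw [← Finset.sum_add_distrib]
    exact Finset.sum_congr rfl fun j _ => hsplit i j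
  have hfilt : ∑ i, ∑ j ∈ univ.filter (fun j => i < j), f i j
      = ∑ i, ∑ j, (if i < j then f i j else 0) := by
    refine Finset.sum_congr rfl fun i _ => ?_
    rw [Finset.sum_filter]
  rw [hfilt, htot, hlow]
  ring

namespace Params

/-- The structure-preserving data of a classical network-reduced model: every internal node is a
generator node (`gen = univ`), couplings `b_ij = C_ij = E_iE_jB_ij`, net powers
`P⁰_i = P_i − E_i²G_ii` [cite: Padiyar2013, §2.2.4 Remark 2]; [cite: SauerPai1998, §7.9.3
eq (7.213)]. Faithful to model-1's vector field exactly when the reduced network is LOSSLESS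
(`ofClassical_pe`). MODELLED: MODEL-VALIDITY rows MV-2L / MV-3. -/
def ofClassical (p : ClassicalSwing n) : Params n :=
  ⟨p.M, p.D, fun i => p.P i - p.E i ^ 2 * p.G i i, fun i j => p.Ccoef i j, univ⟩

variable (p : ClassicalSwing n)

/-- Same inertia constants. -/
@[simp] theorem ofClassical_M : (ofClassical p).M = p.M := rfl

/-- Same damping coefficients. -/
@[simp] theorem ofClassical_D : (ofClassical p).D = p.D := rfl

/-- Net powers `P⁰_i = P_i − E_i²G_ii`. -/
@[simp] theorem ofClassical_P0 (i : Fin n) : (ofClassical p).P0 i = p.P i - p.E i ^ 2 * p.G i i :=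
  rfl

/-- Couplings `b_ij = C_ij = E_iE_jB_ij`. -/
@[simp] theorem ofClassical_b (i j : Fin n) : (ofClassical p).b i j = p.Ccoef i j := rfl

/-- Every node is a generator internal node. -/
@[simp] theorem ofClassical_gen : (ofClassical p).gen = univ := rfl

/-- Symmetry of the couplings `C_ij` from the symmetry of `B`. -/
theorem Ccoef_symm (hB : ∀ i j, p.B i j = p.B j i) (i j : Fin n) : p.Ccoef i j = p.Ccoef j i := by
  simp only [ClassicalSwing.Ccoef, hB i j]; ring

/-- Symmetric reduced susceptances give symmetric structure-preserving couplings. -/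
theorem ofClassical_b_symm (hB : ∀ i j, p.B i j = p.B j i) (i j : Fin n) :
    (ofClassical p).b i j = (ofClassical p).b j i := by
  rw [ofClassical_b, ofClassical_b]
  exact Ccoef_symm p hB i j

/-- The printed sign pattern: positive inertias and dampings and a symmetric reduced susceptance
matrix make the structure-preserving data well formed (no load buses, so `Mᵢ = 0 off gen` is
vacuous). -/
theorem wellFormed_ofClassical (hM : ∀ i, 0 < p.M i) (hD : ∀ i, 0 < p.D i)
    (hB : ∀ i j, p.B i j = p.B j i) : (ofClassical p).WellFormed where
  M_pos := fun i _ => hM i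
  M_eq_zero := fun i hi => absurd (mem_univ i) hi
  D_pos := hD
  b_symm := ofClassical_b_symm p hB

/-- **Lossless internal-node injections are structure-preserving injections**: with `G_ij = 0`
(`i ≠ j`), model-1's `P_ei(δ) = E_i²G_ii + Σ_j C_ij sin(δ_i − δ_j)`, i.e.
`fᵢ(δ) = P_ei(δ) − E_i²G_ii` [cite: SauerPai1998, §7.9.3 eq (7.212)];
[cite: Padiyar2013, §2.2.4 eq (2.30) and Remark 2]. -/
theorem ofClassical_pe (hl : p.IsLossless) (δ : Fin n → ℝ) (i : Fin n) :
    (ofClassical p).pe δ i = p.Pe δ i - p.E i ^ 2 * p.G i i := by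
  rw [pe_eq_sum_erase, ClassicalSwing.Pe]
  have h : ∀ j ∈ univ.erase i, p.Ccoef i j * Real.sin (δ i - δ j)
      + p.Dcoef i j * Real.cos (δ i - δ j) = p.Ccoef i j * Real.sin (δ i - δ j) := by
    intro j hj
    have hne : i ≠ j := (Finset.ne_of_mem_erase hj).symm
    simp [ClassicalSwing.Dcoef, hl i j hne]
  rw [Finset.sum_congr rfl h]
  simp only [ofClassical_b]
  ring

/-- Model-1's vector field satisfies model-2's node equation: for the lossless model with
`Mᵢ ≠ 0`, at every state `x = (δ, ω)`,
`Mᵢ · (dωᵢ/dt) + Dᵢ ωᵢ + fᵢ(δ) = P⁰ᵢ` [cite: Padiyar2013, §3.2 eq (3.2)] where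
`dωᵢ/dt = (Pᵢ − P_ei(δ) − Dᵢωᵢ)/Mᵢ` [cite: SauerPai1998, §7.9.3 eqs (7.215)–(7.216)]. -/
theorem swing_ofClassical (hl : p.IsLossless) (hM : ∀ i, p.M i ≠ 0)
    (x : ClassicalSwing.State n) (i : Fin n) :
    p.M i * (p.field x).2 i + p.D i * x.2 i + (ofClassical p).pe x.1 i = (ofClassical p).P0 i := by
  rw [ofClassical_pe p hl, ofClassical_P0]
  simp only [ClassicalSwing.field]
  field_simp [hM i]
  ring

/-- **Power balance is forced by a synchronous equilibrium** (lossless model, symmetric `B`):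
if `δˢ` is an equilibrium configuration (`P_ei(δˢ) = Pᵢ` for all `i`) then
`Σᵢ (Pᵢ − Eᵢ²Gᵢᵢ) = 0` — the injections of a lossless network sum to zero
(`sum_pe_eq_zero`). -/
theorem sum_P0_eq_zero_of_isEquilibrium (hl : p.IsLossless) (hB : ∀ i j, p.B i j = p.B j i)
    {δs : Fin n → ℝ} (hs : p.IsEquilibrium δs) : ∑ i, (p.P i - p.E i ^ 2 * p.G i i) = 0 := by
  have h0 := (ofClassical p).sum_pe_eq_zero (ofClassical_b_symm p hB) δs
  rw [← h0]
  refine Finset.sum_congr rfl fun i _ => ?_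
  rw [ofClassical_pe p hl, hs i]

/-- **No synchronous equilibrium under a generation–load imbalance** (lossless model, symmetric
`B`): if `Σᵢ (Pᵢ − Eᵢ²Gᵢᵢ) ≠ 0` then NO angle configuration is an equilibrium of model-1's
classical model at synchronous speed — the kernel form of PARTITION A11″ / MODEL-VALIDITY MV-ω
(«after the switching event the constant mechanical inputs no longer balance … the model has no
equilibrium at synchronous speed»; damped solutions then synchronise at `ω_s + ω∞`,
`isSolution_shift_ofClassical`). -/
theorem not_isEquilibrium_of_sum_ne_zero (hl : p.IsLossless) (hB : ∀ i j, p.B i j = p.B j i)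
    (hne : ∑ i, (p.P i - p.E i ^ 2 * p.G i i) ≠ 0) (δs : Fin n → ℝ) : ¬ p.IsEquilibrium δs :=
  fun hs => hne (sum_P0_eq_zero_of_isEquilibrium p hl hB hs)

/-- At an equilibrium of the lossless model the synchronous frequency deviation `ω₀ = ΣP⁰/ΣD` of
the structure-preserving data vanishes [cite: Padiyar2013, §3.2 eq (3.3)]. -/
theorem syncFreq_ofClassical_eq_zero (hl : p.IsLossless) (hB : ∀ i j, p.B i j = p.B j i)
    {δs : Fin n → ℝ} (hs : p.IsEquilibrium δs) : (ofClassical p).syncFreq = 0 := by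
  rw [syncFreq]
  have h : ∑ i, (ofClassical p).P0 i = 0 := by
    simpa only [ofClassical_P0] using sum_P0_eq_zero_of_isEquilibrium p hl hB hs
  rw [h, zero_div]

/-- Hence `P̄ = P⁰` for such data [cite: Padiyar2013, §3.2 eq (3.5)]. -/
theorem Pbar_ofClassical_eq (hl : p.IsLossless) (hB : ∀ i j, p.B i j = p.B j i)
    {δs : Fin n → ℝ} (hs : p.IsEquilibrium δs) (i : Fin n) :
    (ofClassical p).Pbar i = (ofClassical p).P0 i := by
  rw [Pbar, syncFreq_ofClassical_eq_zero p hl hB hs, mul_zero, sub_zero]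

/-- Model-1's equilibrium configurations are model-2's synchronous equilibria of the
structure-preserving data (lossless, symmetric `B`). -/
theorem isSyncEquilibrium_ofClassical (hl : p.IsLossless) (hB : ∀ i j, p.B i j = p.B j i)
    {δs : Fin n → ℝ} (hs : p.IsEquilibrium δs) : (ofClassical p).IsSyncEquilibrium δs := by
  intro i
  rw [Pbar_ofClassical_eq p hl hB hs, ofClassical_pe p hl, ofClassical_P0, hs i]

/-! ## Solutions correspond -/

/-- Angle components of a model-1 solution: `dδᵢ/dt = ωᵢ`. -/
theorem hasDerivAt_angle {γ : ℝ → ClassicalSwing.State n} {t : ℝ}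
    (hγ : HasDerivAt γ (p.field (γ t)) t) (i : Fin n) :
    HasDerivAt (fun s => (γ s).1 i) ((γ t).2 i) t :=
  hasDerivAt_pi.1
    ((ContinuousLinearMap.fst ℝ (Fin n → ℝ) (Fin n → ℝ)).hasFDerivAt.comp_hasDerivAt t hγ) i

/-- Speed components of a model-1 solution: `dωᵢ/dt = (Pᵢ − P_ei(δ) − Dᵢωᵢ)/Mᵢ`. -/
theorem hasDerivAt_speed {γ : ℝ → ClassicalSwing.State n} {t : ℝ}
    (hγ : HasDerivAt γ (p.field (γ t)) t) (i : Fin n) :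
    HasDerivAt (fun s => (γ s).2 i) ((p.P i - p.Pe (γ t).1 i - p.D i * (γ t).2 i) / p.M i) t :=
  hasDerivAt_pi.1
    ((ContinuousLinearMap.snd ℝ (Fin n → ℝ) (Fin n → ℝ)).hasFDerivAt.comp_hasDerivAt t hγ) i

/-- **Model-1 solutions are model-2 solutions** (lossless, `Mᵢ ≠ 0`): if `γ = (δ, ω)` solves the
classical model on all of `ℝ` in model-1's sense, then the angle trajectory solves the
structure-preserving equations (3.2) of the `gen = univ` data in model-2's sense, and the speeds
ARE the angle derivatives. -/
theorem isSolution_ofClassical (hl : p.IsLossless) (hM : ∀ i, p.M i ≠ 0)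
    {γ : ℝ → ClassicalSwing.State n} (hγ : p.IsSolutionOn γ Set.univ) :
    (ofClassical p).IsSolution (fun t => (γ t).1) ∧ ∀ t i, deriv (fun s => (γ s).1 i) t = (γ t).2 i := by
  have hγ' : ∀ t, HasDerivAt γ (p.field (γ t)) t := fun t =>
    (hγ t (Set.mem_univ t)).hasDerivAt Filter.univ_mem
  have hδ : ∀ t i, HasDerivAt (fun s => (γ s).1 i) ((γ t).2 i) t := fun t i =>
    hasDerivAt_angle p (hγ' t) i
  have hderiv : ∀ i, deriv (fun s => (γ s).1 i) = fun t => (γ t).2 i := fun i => by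
    funext t; exact (hδ t i).deriv
  have hω : ∀ t i, HasDerivAt (fun s => (γ s).2 i)
      ((p.P i - p.Pe (γ t).1 i - p.D i * (γ t).2 i) / p.M i) t := fun t i =>
    hasDerivAt_speed p (hγ' t) i
  refine ⟨⟨fun i t => (hδ t i).differentiableAt, fun i _ => ?_, fun t i => ?_⟩,
    fun t i => (hδ t i).deriv⟩
  · rw [hderiv i]
    exact fun t => (hω t i).differentiableAt
  · rw [hderiv i, (hω t i).deriv]
    have h := swing_ofClassical p hl hM (γ t) i
    simpa only [ClassicalSwing.field, ofClassical_M, ofClassical_D] using h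

/-- **Rotating frame for classical solutions** (MV-ω): along a model-1 solution, the angles
shifted by `−ω₀ t`, `ω₀ = Σᵢ(Pᵢ − Eᵢ²Gᵢᵢ)/ΣᵢDᵢ`, solve the structure-preserving equations with
the balanced powers `P̄` [cite: Padiyar2013, §3.2 eqs (3.3)–(3.5)] — transported from
`IsSolution.shift`. -/
theorem isSolution_shift_ofClassical (hl : p.IsLossless) (hM : ∀ i, p.M i ≠ 0)
    {γ : ℝ → ClassicalSwing.State n} (hγ : p.IsSolutionOn γ Set.univ) :
    (ofClassical p).shifted.IsSolution (fun t i => (γ t).1 i - (ofClassical p).syncFreq * t) :=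
  (isSolution_ofClassical p hl hM hγ).1.shift

/-! ## The classical energy function is Bergen–Hill's topological energy (`gen = univ`) -/

/-- **Energy functions agree at an equilibrium.** For the lossless model with symmetric `B` and an
equilibrium configuration `δˢ`, model-1's classical transient energy
`V(δ, ω) = ½ΣMᵢωᵢ² − Σ(Pᵢ − Eᵢ²Gᵢᵢ)(δᵢ − δᵢˢ) − Σ_{i<j} C_ij(cos δ_ij − cos δˢ_ij)`
[cite: SauerPai1998, §9] equals Bergen–Hill's `V = ½ ω_gᵀM_gω_g + Σ_branches b_k ∫(sin β − sin σ_k0)dβ`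
[cite: Padiyar2013, §3.2 eqs (3.11)–(3.14)] for the `gen = univ` data: the `(σ − σ₀) sin σ₀`
parts of the branch integrals sum, through the equilibrium equations `Σⱼ C_ij sin δˢ_ij = Pᵢ − Eᵢ²Gᵢᵢ`,
to the linear rotor-position term. -/
theorem ofClassical_energy (hl : p.IsLossless) (hB : ∀ i j, p.B i j = p.B j i)
    {δs : Fin n → ℝ} (hs : p.IsEquilibrium δs) (δ ω : Fin n → ℝ) :
    (ofClassical p).energy δs δ ω = p.energy δs (δ, ω) := by
  have hC : ∀ i j, p.Ccoef i j = p.Ccoef j i := Ccoef_symm p hB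
  -- equilibrium equations in coupling form
  have hP : ∀ i, ∑ j, p.Ccoef i j * Real.sin (δs i - δs j) = p.P i - p.E i ^ 2 * p.G i i := by
    intro i
    have h := ofClassical_pe p hl δs i
    rw [hs i] at h
    simpa only [pe, ofClassical_b] using h
  -- the linear term
  have hanti : ∀ i j, Real.sin (δs j - δs i) = -Real.sin (δs i - δs j) := by
    intro i j; rw [← Real.sin_neg, neg_sub]
  have hlin : (1 / 2) * ∑ i, ∑ j, p.Ccoef i j * (((δ i - δs i) - (δ j - δs j))
        * Real.sin (δs i - δs j)) = ∑ i, (p.P i - p.E i ^ 2 * p.G i i) * (δ i - δs i) := by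
    rw [half_sum_sub_mul_antisymm (fun i j => p.Ccoef i j) (fun i j => Real.sin (δs i - δs j))
      (fun i => δ i - δs i) hC hanti]
    refine Finset.sum_congr rfl fun i _ => ?_
    rw [hP i]
    ring
  -- the cosine term
  have hcos : ∑ i, ∑ j ∈ univ.filter (fun j => i < j),
        p.Ccoef i j * (Real.cos (δ i - δ j) - Real.cos (δs i - δs j))
      = (1 / 2) * ∑ i, ∑ j, p.Ccoef i j * (Real.cos (δ i - δ j) - Real.cos (δs i - δs j)) := by
    refine sum_upper_eq_half_sum _ (fun i j => ?_) (fun i => by simp)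
    rw [hC i j, ← Real.cos_neg (δ i - δ j), ← Real.cos_neg (δs i - δs j), neg_sub, neg_sub]
  -- split the branch energies into the linear and the cosine parts
  have hsplit : (ofClassical p).potential δs δ
      = -((1 / 2) * ∑ i, ∑ j, p.Ccoef i j * (((δ i - δs i) - (δ j - δs j))
          * Real.sin (δs i - δs j)))
        - (1 / 2) * ∑ i, ∑ j, p.Ccoef i j * (Real.cos (δ i - δ j) - Real.cos (δs i - δs j)) := by
    have hterm : ∀ i j, (ofClassical p).b i j * branchEnergy (δ i - δ j) (δs i - δs j)
        = -(p.Ccoef i j * (((δ i - δs i) - (δ j - δs j)) * Real.sin (δs i - δs j)))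
          - p.Ccoef i j * (Real.cos (δ i - δ j) - Real.cos (δs i - δs j)) := by
      intro i j
      simp only [ofClassical_b, branchEnergy]
      ring
    rw [potential]
    simp_rw [hterm, Finset.sum_sub_distrib, Finset.sum_neg_distrib]
    ring
  have hkin : (ofClassical p).kinetic ω = (∑ i, p.M i * ω i ^ 2) / 2 := by
    rw [kinetic, ofClassical_gen, ofClassical_M]
    ring
  show (ofClassical p).kinetic ω + (ofClassical p).potential δs δ
    = (∑ i, p.M i * ω i ^ 2) / 2 - ∑ i, (p.P i - p.E i ^ 2 * p.G i i) * (δ i - δs i)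
      - ∑ i, ∑ j ∈ univ.filter (fun j => i < j),
          p.Ccoef i j * (Real.cos (δ i - δ j) - Real.cos (δs i - δs j))
  rw [hkin, hsplit, hlin, hcos]
  ring

/-- **Dissipation identity for model-1's classical energy function** (lossless, symmetric `B`,
`Mᵢ > 0`, `Dᵢ > 0`, equilibrium `δˢ`): along every model-1 solution `γ = (δ, ω)` on `ℝ`,
`d/dt V(δ(t), ω(t)) = −Σᵢ Dᵢ ωᵢ(t)²` — Bergen–Hill's Lyapunov computation
[cite: Padiyar2013, §3.2 eqs (3.10)–(3.14)] specialised to `gen = univ`, i.e. the printed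
statement «V̇ ≤ 0 in the presence of mechanical damping» for the internal-node model
[cite: SauerPai1998, §9 eq (9.59) and the uniform-damping discussion]. Obtained from model-2's
`hasDerivAt_energy` through the dictionary; no calculus re-derived. -/
theorem hasDerivAt_classicalEnergy (hl : p.IsLossless) (hB : ∀ i j, p.B i j = p.B j i)
    (hM : ∀ i, 0 < p.M i) (hD : ∀ i, 0 < p.D i) {δs : Fin n → ℝ} (hs : p.IsEquilibrium δs)
    {γ : ℝ → ClassicalSwing.State n} (hγ : p.IsSolutionOn γ Set.univ) (t : ℝ) :
    HasDerivAt (fun s => p.energy δs (γ s)) (-∑ i, p.D i * (γ t).2 i ^ 2) t := by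
  have hwf := wellFormed_ofClassical p hM hD hB
  obtain ⟨hsol, hv⟩ := isSolution_ofClassical p hl (fun i => (hM i).ne') hγ
  -- the shifted data coincide with the data here (ω₀ = 0), so `hsol` serves `hasDerivAt_energy`
  have hsol' : (ofClassical p).shifted.IsSolution (fun t => (γ t).1) := by
    refine ⟨hsol.differentiable, fun i _ => hsol.differentiable_deriv i (by simp), ?_⟩
    intro s i
    simp only [shifted_M, shifted_D, shifted_pe, shifted_P0, Pbar_ofClassical_eq p hl hB hs]
    exact hsol.swing s i
  have h := hasDerivAt_energy hwf (isSyncEquilibrium_ofClassical p hl hB hs) hsol' t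
  have hfun : (fun s => (ofClassical p).energy δs (γ s).1 fun i => deriv (fun u => (γ u).1 i) s)
      = fun s => p.energy δs (γ s) := by
    funext s
    have hω : (fun i => deriv (fun u => (γ u).1 i) s) = (γ s).2 := by
      funext i; exact hv s i
    rw [hω, ofClassical_energy p hl hB hs]
  rw [hfun] at h
  simpa only [ofClassical_D, hv] using h

end Params

end Summit.Ventures.GridStability.Models.StructurePreserving

end
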